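import Summits.ValiantsHypothesis.ValiantsHypothesis.Theorems.KPlusLogSqLawTropicalBVisitedImages

/-!
# Route «KPlusLogSqLaw», crux `TropicalB` (stmt-ValiantsHypothesis-19771) — VISITED IMAGES WITH AN EXPONENTIAL BUDGET: what the
# desk's target (β) must deliver for `TropicalB` and for the foothold `stub_tropTowerLog`, pinned in the kernel

HONEST FRAMING.  Helper toward the registered stubs of `Cruxes/TropicalB/Lines/birth.lean` (crux
`Summit.ValiantsHypothesis.ValiantsHypothesis.Theses.KPlusLogSqLaw.TropicalB`, item stmt-ValiantsHypothesis-19771, route KPlusLogSqLaw, DRAFT;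
cell `pub-symmetroid`, seat val-sym-trop-p1 g12, 2026-08-27; `--supports … --as helper`).  Arithmetic repackaging of the VISITED-IMAGE LAW
`IntervalOpt.chain_le_of_visitedImages` (val-sym-trop-p1 g7: in ANY design, a dominant chain visiting at most `V` row images `σ_k([a,t))` on
every column interval has `n + 1 ≤ (mK+1)·(2V)^{⌊log₂ m⌋+1}`) with an EXPONENTIAL image budget `V = 2^B`, so that the two A-moving targets the
desk names together («(β) a bound on visited images for GENERAL dominant chains, or `stub_tropTowerLog`», R2047 (4) / director word
2026-08-27) are related by explicit inequalities.  Every theorem is CONDITIONAL on a visited-image hypothesis about the chain at hand; nothing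
here bounds the images of general chains, and nothing bears on `TropicalB` in its window, `WeakLifting`, DoorA26 / DoorA34, `MatrixDescartes`
(stmt-ValiantsHypothesis-18050) or VP ≠ VNP.

* `IntervalOpt.chain_le_of_visitedImages_two_pow` — `V ≤ 2^B` on every interval ⇒ `n + 1 ≤ (mK+1)·2^((B+1)(⌊log₂ m⌋+1))`;
* `IntervalOpt.tropicalB_shape_of_visitedImages_two_pow` — if moreover `(B+1)(⌊log₂ m⌋+1) ≤ c·(K + ⌊log₂ m⌋²)` then
  `n ≤ 2^((c+2)(K + ⌊log₂ m⌋²))`: the (β) budget that gives `TropicalB` with an ABSOLUTE constant is `B = O((K + log² m)/log m)` bits of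
  visited images per interval — polynomially many images (`…VisitedImages.chain_le_two_pow_of_poly_visitedImages`, `(m+1)^w`) is the thin
  end `K ≤ log² m` of it, while in the fat regime `2^{O(K/log m)}` images are affordable;
* `IntervalOpt.towerLog_shape_of_visitedImages` — at the tower format `m = K·⌊log₂ K⌋`: `(B+1)(⌊log₂ m⌋+1) ≤ c·K` ⇒ `n ≤ 2^((c+3)·K)`, i.e.
  `O(K/log K)` bits of visited images per interval give the foothold's inequality for that chain (`K³ + 1 ≤ 8^K` absorbs `mK + 1`);
* `towerLog_of_visitedImages` — the universally quantified form: «every sign-alternating dominant chain of every design of format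
  `(K·⌊log₂ K⌋, K)` visits at most `2^B` images per column interval for some `B` with `(B+1)(⌊log₂ m⌋+1) ≤ c·K`» (hypothesis, NOT claimed) ⇒
  `∃ C, ∀ K, TropRootLawAt (K * Nat.log 2 K) K (2 ^ (C * K))` (`C = c + 3`), the registered signature of `stub_tropTowerLog` up to the
  definitional unfolding `TropRow = TropRootLawAt` — the (β)-companion of `DoublingQuasi.towerLog_of_doublingQuasi_exists`.

[folklore: D. Gusfield (1980), divide and conquer for parametric shortest paths; the bookkeeping is the cell's.]
-/

set_option linter.dupNamespace false
set_option autoImplicit false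

namespace Summit.ValiantsHypothesis.ValiantsHypothesis.Theorems.KPlusLogSqLaw

open Summit.ValiantsHypothesis.ValiantsHypothesis.Theorems.MatrixDescartes.Negative
open Summit.ValiantsHypothesis.ValiantsHypothesis.Theorems.LacunarySymmetroidMatrixDescartes
open Summit.ValiantsHypothesis.ValiantsHypothesis.Theorems.LacunarySymmetroidMatrixDescartes.TropicalCensus
open scoped BigOperators
open Finset

namespace IntervalOpt

variable {m K : ℕ} {d : Fin K → ℕ} {v ε : Fin m → Fin m → Fin K → ℤ}

/-! ## 1. The visited-image law with an exponential budget -/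

/-- **Visited images with budget `2^B`.**  In ANY design of format `(m, K)`: a dominant chain with distinct consecutive terms that visits
at most `2^B` distinct row images `σ_k([a, t))` on every column interval has `n + 1 ≤ (mK+1)·2^((B+1)(⌊log₂ m⌋+1))`.
[folklore: Gusfield 1980, via `chain_le_of_visitedImages`] -/
theorem chain_le_of_visitedImages_two_pow {n : ℕ} (θ : Fin (n + 1) → ℤ)
    (p : Fin (n + 1) → Equiv.Perm (Fin m) × (Fin m → Fin K))
    (hθ : StrictMono θ) (hdom : ∀ k, IsDominant d v ε (θ k) (p k)) (hne : ∀ k : Fin n, p k.castSucc ≠ p k.succ) (B : ℕ)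
    (hV : ∀ a t : ℕ, ((Finset.univ : Finset (Fin (n + 1))).image fun k => (ico m a t).image (p k).1).card ≤ 2 ^ B) :
    n + 1 ≤ (m * K + 1) * 2 ^ ((B + 1) * (Nat.log 2 m + 1)) := by
  have h := chain_le_of_visitedImages (d := d) (v := v) (ε := ε) θ p hθ hdom hne (2 ^ B) Nat.one_le_two_pow hV
  rwa [← pow_succ', ← pow_mul] at h

/-- `mK + 1 ≤ 2^(2(K + ⌊log₂ m⌋²))` for `K ≥ 1`. [arithmetic] -/
theorem mul_succ_le_two_pow_window (m K : ℕ) (hK : 1 ≤ K) : m * K + 1 ≤ 2 ^ (2 * (K + Nat.log 2 m ^ 2)) := by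
  set L := Nat.log 2 m with hL
  have hm : m + 1 ≤ 2 ^ (L + 1) := Nat.lt_pow_succ_log_self one_lt_two m
  have hLL : L + 1 + K ≤ 2 * (K + L ^ 2) := by nlinarith [Nat.zero_le L]
  calc m * K + 1 ≤ (m + 1) * (K + 1) := by nlinarith
    _ ≤ 2 ^ (L + 1) * 2 ^ K := Nat.mul_le_mul hm Nat.lt_two_pow_self
    _ = 2 ^ (L + 1 + K) := (pow_add _ _ _).symm
    _ ≤ 2 ^ (2 * (K + L ^ 2)) := Nat.pow_le_pow_right (by norm_num) hLL

/-- **(β) ⇒ the inequality of `TropicalB`, exponential budget.**  If a dominant chain (distinct consecutive terms) of a design of format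
`(m, K)` visits at most `2^B` row images on every column interval and `(B+1)(⌊log₂ m⌋+1) ≤ c·(K + ⌊log₂ m⌋²)`, then
`n ≤ 2^((c+2)(K + ⌊log₂ m⌋²))` — an ABSOLUTE constant `c + 2`.  So `O((K + log² m)/log m)` bits of visited images per interval is what
target (β) must deliver for the crux. [folklore: Gusfield 1980; bookkeeping] -/
theorem tropicalB_shape_of_visitedImages_two_pow (c B : ℕ) {n : ℕ} (θ : Fin (n + 1) → ℤ)
    (p : Fin (n + 1) → Equiv.Perm (Fin m) × (Fin m → Fin K))
    (hθ : StrictMono θ) (hdom : ∀ k, IsDominant d v ε (θ k) (p k)) (hne : ∀ k : Fin n, p k.castSucc ≠ p k.succ)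
    (hB : (B + 1) * (Nat.log 2 m + 1) ≤ c * (K + Nat.log 2 m ^ 2))
    (hV : ∀ a t : ℕ, ((Finset.univ : Finset (Fin (n + 1))).image fun k => (ico m a t).image (p k).1).card ≤ 2 ^ B) :
    n ≤ 2 ^ ((c + 2) * (K + Nat.log 2 m ^ 2)) := by
  rcases Nat.eq_zero_or_pos K with hK | hK
  · subst hK
    exact (tropRowD_zero m 0 d v ε n θ p hθ hdom hne).trans (Nat.zero_le _)
  · have h1 := chain_le_of_visitedImages_two_pow θ p hθ hdom hne B hV
    have h2 : (m * K + 1) * 2 ^ ((B + 1) * (Nat.log 2 m + 1)) ≤ 2 ^ ((c + 2) * (K + Nat.log 2 m ^ 2)) := by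
      calc (m * K + 1) * 2 ^ ((B + 1) * (Nat.log 2 m + 1))
          ≤ 2 ^ (2 * (K + Nat.log 2 m ^ 2)) * 2 ^ (c * (K + Nat.log 2 m ^ 2)) :=
            Nat.mul_le_mul (mul_succ_le_two_pow_window m K hK) (Nat.pow_le_pow_right (by norm_num) hB)
        _ = 2 ^ ((c + 2) * (K + Nat.log 2 m ^ 2)) := by rw [← pow_add]; ring_nf
    omega

/-! ## 2. The tower format `m = K·⌊log₂ K⌋` -/

/-- `K³ + 1 ≤ 8^K`. [arithmetic] -/
theorem cube_succ_le_eight_pow (K : ℕ) : K ^ 3 + 1 ≤ 8 ^ K := by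
  have h : K < 2 ^ K := Nat.lt_two_pow_self
  have h3 : K ^ 3 < (2 ^ K) ^ 3 := Nat.pow_lt_pow_left h (by norm_num)
  calc K ^ 3 + 1 ≤ (2 ^ K) ^ 3 := h3
    _ = 8 ^ K := by rw [← pow_mul, mul_comm, pow_mul]; norm_num

/-- at the tower format, `mK + 1 ≤ 2^(3K)` (`m = K·⌊log₂ K⌋ ≤ K²`). [arithmetic] -/
theorem tower_mul_succ_le (K : ℕ) : K * Nat.log 2 K * K + 1 ≤ 2 ^ (3 * K) := by
  have hlog : Nat.log 2 K ≤ K := Nat.log_le_self 2 K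
  calc K * Nat.log 2 K * K + 1 ≤ K * K * K + 1 := by nlinarith [Nat.zero_le K]
    _ = K ^ 3 + 1 := by ring
    _ ≤ 8 ^ K := cube_succ_le_eight_pow K
    _ = 2 ^ (3 * K) := by rw [pow_mul]; norm_num

/-- **(β) ⇒ the foothold's inequality at the tower format.**  For a design of format `(K·⌊log₂ K⌋, K)`: a dominant chain (distinct
consecutive terms) visiting at most `2^B` row images on every column interval with `(B+1)(⌊log₂ m⌋+1) ≤ c·K` has `n ≤ 2^((c+3)·K)` —
`O(K/log K)` bits of visited images per interval give `stub_tropTowerLog`'s bound for that chain. [folklore: Gusfield 1980; bookkeeping] -/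
theorem towerLog_shape_of_visitedImages (c B K : ℕ) {d : Fin K → ℕ}
    {v ε : Fin (K * Nat.log 2 K) → Fin (K * Nat.log 2 K) → Fin K → ℤ} {n : ℕ} (θ : Fin (n + 1) → ℤ)
    (p : Fin (n + 1) → Equiv.Perm (Fin (K * Nat.log 2 K)) × (Fin (K * Nat.log 2 K) → Fin K))
    (hθ : StrictMono θ) (hdom : ∀ k, IsDominant d v ε (θ k) (p k)) (hne : ∀ k : Fin n, p k.castSucc ≠ p k.succ)
    (hB : (B + 1) * (Nat.log 2 (K * Nat.log 2 K) + 1) ≤ c * K)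
    (hV : ∀ a t : ℕ, ((Finset.univ : Finset (Fin (n + 1))).image fun k =>
      (ico (K * Nat.log 2 K) a t).image (p k).1).card ≤ 2 ^ B) :
    n ≤ 2 ^ ((c + 3) * K) := by
  have h1 := chain_le_of_visitedImages_two_pow θ p hθ hdom hne B hV
  have h2 : (K * Nat.log 2 K * K + 1) * 2 ^ ((B + 1) * (Nat.log 2 (K * Nat.log 2 K) + 1)) ≤ 2 ^ ((c + 3) * K) := by
    calc (K * Nat.log 2 K * K + 1) * 2 ^ ((B + 1) * (Nat.log 2 (K * Nat.log 2 K) + 1))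
        ≤ 2 ^ (3 * K) * 2 ^ (c * K) := Nat.mul_le_mul (tower_mul_succ_le K) (Nat.pow_le_pow_right (by norm_num) hB)
      _ = 2 ^ ((c + 3) * K) := by rw [← pow_add]; ring_nf
  omega

end IntervalOpt

open IntervalOpt in
/-- **`(β)_tower ⇒ TowerLog`** (universally quantified, crux currency).  HYPOTHESIS (NOT claimed): for some `c`, every sign-alternating
dominant chain of every design of format `(K·⌊log₂ K⌋, K)` visits, on every column interval, at most `2^B` row images for some `B` with
`(B+1)(⌊log₂ m⌋+1) ≤ c·K`.  CONCLUSION: `∃ C, ∀ K, TropRootLawAt (K * Nat.log 2 K) K (2 ^ (C * K))` (`C = c + 3`) — the registered signature of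
`stub_tropTowerLog` of `Cruxes/TropicalB/Lines/birth.lean` up to the definitional unfolding `TropRow = TropRootLawAt`; the (β)-companion of
`DoublingQuasi.towerLog_of_doublingQuasi_exists`. [folklore: Gusfield 1980; bookkeeping] -/
theorem towerLog_of_visitedImages
    (hβ : ∃ c : ℕ, ∀ (K : ℕ) (d : Fin K → ℕ) (v ε : Fin (K * Nat.log 2 K) → Fin (K * Nat.log 2 K) → Fin K → ℤ) (n : ℕ)
      (θ : Fin (n + 1) → ℤ) (p : Fin (n + 1) → Equiv.Perm (Fin (K * Nat.log 2 K)) × (Fin (K * Nat.log 2 K) → Fin K)),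
      (∀ i j l, (ε i j l).natAbs ≤ 1) → StrictMono θ → (∀ k, IsDominant d v ε (θ k) (p k)) →
      (∀ k : Fin n, termSign ε (p k.castSucc) * termSign ε (p k.succ) < 0) →
      ∃ B : ℕ, (B + 1) * (Nat.log 2 (K * Nat.log 2 K) + 1) ≤ c * K ∧
        ∀ a t : ℕ, ((Finset.univ : Finset (Fin (n + 1))).image fun k =>
          (ico (K * Nat.log 2 K) a t).image (p k).1).card ≤ 2 ^ B) :
    ∃ C : ℕ, ∀ K : ℕ, TropRootLawAt (K * Nat.log 2 K) K (2 ^ (C * K)) := by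
  obtain ⟨c, hc⟩ := hβ
  refine ⟨c + 3, fun K d v ε n θ p hε hθ hdom halt => ?_⟩
  obtain ⟨B, hB, hV⟩ := hc K d v ε n θ p hε hθ hdom halt
  exact towerLog_shape_of_visitedImages c B K θ p hθ hdom (ne_succ_of_alternating ε p halt) hB hV

end Summit.ValiantsHypothesis.ValiantsHypothesis.Theorems.KPlusLogSqLaw
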